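import Literature.AlgebraicGeometry.Motives.MixedHodgeStructureSplitOverQ
import Literature.AlgebraicGeometry.Motives.MixedHodgeStructureSplitOverR
import HarnessLib

/-!
# `ℚ`-split mixed Hodge structures: split over `ℝ`; sub-objects, quotients, isomorphic copies

Green–Griffiths–Kerr, *Mumford–Tate groups and domains*, §I.C (I.C.7)–(I.C.8) and footnote 3 (`ℚ`-split
MHS = "general Hodge structures" `⊕ᵢ Gr^W_i V`), (I.C.11) (iii): "As `V^split` is a direct sum of pure Hodge
structures, `φ̂_split` is defined over `ℝ`". Brosnan–Pearlstein, Def. 2.1.3 / Lemma 2.1.4: split over `ℝ`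
(`conj I^{p,q} = I^{q,p}`; the tree's `IsSplitOverR`). Cattani–El Zein–Griffiths–Lê, Prop. 3.2.19 and
Remark (i)–(ii) after it (`I^{p,q} ≡ conj I^{q,p} mod W_{p+q-2}`; morphisms respect `⊕ I^{p,q}`),
Lemma 3.2.20 (sub-objects and quotients).

Continuing `Motives/MixedHodgeStructureSplitOverQ` (`deligneE H n = ⊕_{p+q=n} I^{p,q}`, `IsSplitOverQ`):

* §1 morphisms map `E_n` into `E_n` (`Hom.map_deligneE_le`), isomorphisms onto (`map_deligneE_eq_of_bijective`);
  **`E_n` of a sub-MHS is the trace of `E_n`** (`SubMixedHodgeStructure.deligneE_eq_comap`) and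
  **`E_n` of a quotient is the image of `E_n`** (`SubMixedHodgeStructure.deligneE_quotient_eq`).
* §2 **a `ℚ`-split MHS is split over `ℝ`** (`IsSplitOverQ.isSplitOverR`): `conj I^{p,q} ⊆ I^{q,p} + W_{n-1,ℂ}`
  and `conj I^{p,q} ⊆ conj E_n = E_n`, while `E_n ∩ W_{n-1,ℂ} = 0`.
* §3 **sub-MHS, quotients and isomorphic copies of `ℚ`-split MHS are `ℚ`-split**
  (`IsSplitOverQ.subMixedHodgeStructure`, `IsSplitOverQ.quotient`, `IsSplitOverQ.of_bijective`,
  `IsSplitOverQ.ker/range/coker`).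

All statements proved; no definitions, no named facts.

## References

* [GreenGriffithsKerr2012] M. Green, P. Griffiths, M. Kerr, Mumford–Tate groups and domains (2012), §I.C
  (I.C.7)–(I.C.8), (I.C.11) (iii), footnote 3.
* [BrosnanPearlstein2009Duke] P. Brosnan, G. Pearlstein, Duke Math. J. 150 (2009), §2.1 Def. 2.1.3, Lemma 2.1.4.
* [CattaniElZeinGriffithsLe2014] E. Cattani et al. (eds.), Hodge Theory (2014), Prop. 3.2.19 and Remarks
  (i)–(ii), Lemma 3.2.20.
-/

noncomputable section

open scoped TensorProduct

namespace Literature.AlgebraicGeometry.Motives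

namespace MixedHodgeStructure

open HodgeStructure (complexConj complexConj_mono)
open Literature.LinearAlgebra.BaseChange (baseChange_map baseChange_comap)

universe u v

variable {V : Type u} [AddCommGroup V] [Module ℚ V]
variable {V' : Type v} [AddCommGroup V'] [Module ℚ V']
variable {H : MixedHodgeStructure V} {H' : MixedHodgeStructure V'}

/-! ### §1 `E_n` under morphisms, sub-objects and quotients -/

/-- **Morphisms of MHS map `E_n` into `E_n`.** [cite: CattaniElZeinGriffithsLe2014, Prop. 3.2.19, Remark (ii)] -/
theorem Hom.map_deligneE_le (f : Hom H H') (n : ℤ) :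
    (H.deligneE n).map (f.toLinearMap.baseChange ℂ) ≤ H'.deligneE n := by
  rw [deligneE, Submodule.map_iSup]
  refine iSup_le fun pq => ?_
  rw [Submodule.map_iSup]
  exact iSup_le fun hpq => (f.map_deligneI_le pq.1 pq.2).trans (H'.deligneI_le_deligneE hpq)

/-- An isomorphism of MHS maps `E_n` onto `E_n`. [cite: CattaniElZeinGriffithsLe2014, Thm. 3.2.18] -/
theorem map_deligneE_eq_of_bijective [FiniteDimensional ℚ V] [FiniteDimensional ℚ V'] (f : Hom H H')
    (hf : Function.Bijective f.toLinearMap) (n : ℤ) :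
    (H.deligneE n).map (f.toLinearMap.baseChange ℂ) = H'.deligneE n := by
  refine le_antisymm (f.map_deligneE_le n) (iSup₂_le fun pq hpq => ?_)
  rw [show H'.deligneFamily pq = H'.deligneI pq.1 pq.2 from rfl, ← Hom.map_deligneI_eq_of_bijective f hf pq.1 pq.2]
  exact Submodule.map_mono (H.deligneI_le_deligneE hpq)

/-- The weight filtration of a sub-MHS, complexified: `W_n(S)_ℂ = ι_ℂ⁻¹(W_{n,ℂ})`.
[cite: CattaniElZeinGriffithsLe2014, Lemma 3.2.20] -/
theorem SubMixedHodgeStructure.baseChange_W_eq_comap (S : SubMixedHodgeStructure H) (n : ℤ) :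
    (S.toMixedHodgeStructure.W n).baseChange ℂ = ((H.W n).baseChange ℂ).comap (S.toSubmodule.subtype.baseChange ℂ) :=
  baseChange_comap ℂ S.toSubmodule.subtype (H.W n)

/-- **`E_n(S) = ι_ℂ⁻¹(E_n(H))` for a sub-MHS `S ⊆ H`** (the splitting of a sub-object is the trace of the
splitting). [cite: CattaniElZeinGriffithsLe2014, Lemma 3.2.20] -/
theorem SubMixedHodgeStructure.deligneE_eq_comap (S : SubMixedHodgeStructure H) (n : ℤ) :
    S.toMixedHodgeStructure.deligneE n = (H.deligneE n).comap (S.toSubmodule.subtype.baseChange ℂ) := by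
  refine le_antisymm (Submodule.map_le_iff_le_comap.1 (S.subtype.map_deligneE_le n)) fun x hx => ?_
  rw [Submodule.mem_comap] at hx
  -- `x ∈ W_n(S)_ℂ = W_{n-1}(S)_ℂ + E_n(S)`
  have hxW : x ∈ (S.toMixedHodgeStructure.W n).baseChange ℂ := by
    rw [S.baseChange_W_eq_comap]
    exact H.deligneE_le_baseChange_W n hx
  rw [S.toMixedHodgeStructure.baseChange_W_eq_baseChange_W_pred_sup_deligneE n] at hxW
  obtain ⟨w, hw, e, he, rfl⟩ := Submodule.mem_sup.1 hxW
  -- `ι_ℂ w ∈ E_n(H) ∩ W_{n-1,ℂ} = 0`, and `ι_ℂ` is injective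
  have hιe : S.toSubmodule.subtype.baseChange ℂ e ∈ H.deligneE n :=
    S.subtype.map_deligneE_le n ⟨e, he, rfl⟩
  have hιw : S.toSubmodule.subtype.baseChange ℂ w ∈ H.deligneE n ⊓ (H.W (n - 1)).baseChange ℂ := by
    refine ⟨?_, ?_⟩
    · have h := Submodule.sub_mem _ hx hιe
      rwa [map_add, add_sub_cancel_right] at h
    · have hw' := hw
      rw [S.baseChange_W_eq_comap] at hw'
      exact hw'
  rw [H.deligneE_inf_baseChange_W_pred n, Submodule.mem_bot] at hιw
  have hw0 : w = 0 := baseChange_injective S.toSubmodule.injective_subtype (by rw [hιw, map_zero])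
  rw [hw0, zero_add]
  exact he

/-- **`E_n(H/S) = π_ℂ(E_n(H))` for the quotient by a sub-MHS.** [cite: CattaniElZeinGriffithsLe2014, Lemma 3.2.20] -/
theorem SubMixedHodgeStructure.deligneE_quotient_eq [FiniteDimensional ℚ V] (S : SubMixedHodgeStructure H) (n : ℤ) :
    S.quotient.deligneE n = (H.deligneE n).map (S.toSubmodule.mkQ.baseChange ℂ) := by
  rw [deligneE, deligneE, Submodule.map_iSup]
  refine iSup_congr fun pq => ?_
  rw [Submodule.map_iSup]
  exact iSup_congr fun _ => S.deligneI_quotient_eq pq.1 pq.2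

/-! ### §2 `ℚ`-split ⇒ split over `ℝ` -/

/-- For a `ℚ`-split MHS each `E_n` is real: `conj E_n = E_n`. [cite: GreenGriffithsKerr2012, §I.C (I.C.11) (iii)] -/
theorem IsSplitOverQ.complexConj_deligneE (h : H.IsSplitOverQ) (n : ℤ) : complexConj (H.deligneE n) = H.deligneE n := by
  obtain ⟨U, hU⟩ := h n
  rw [← hU, complexConj_baseChange]

/-- **A mixed Hodge structure split over `ℚ` is split over `ℝ`**: `conj I^{p,q} ⊆ (I^{q,p} + W_{p+q-1,ℂ}) ∩ E_{p+q}
= I^{q,p}` by the modular law, since `E_{p+q} ∩ W_{p+q-1,ℂ} = 0`. [cite: GreenGriffithsKerr2012, §I.C (I.C.11) (iii)] -/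
theorem IsSplitOverQ.isSplitOverR (h : H.IsSplitOverQ) : H.IsSplitOverR := by
  refine H.isSplitOverR_of_le fun p q => ?_
  have h1 : complexConj (H.deligneI p q) ≤ H.deligneE (p + q) := by
    rw [← h.complexConj_deligneE (p + q)]
    exact complexConj_mono (H.deligneI_le_deligneE rfl)
  have h2 := H.complexConj_deligneI_le p q
  have hmod : (H.deligneI q p ⊔ (H.W (p + q - 1)).baseChange ℂ) ⊓ H.deligneE (p + q) = H.deligneI q p := by
    rw [sup_inf_assoc_of_le _ (H.deligneI_le_deligneE (add_comm q p)), inf_comm,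
      H.deligneE_inf_baseChange_W_pred (p + q), sup_bot_eq]
  exact (le_inf h2 h1).trans hmod.le

/-! ### §3 Sub-objects, quotients and isomorphic copies -/

/-- **A sub-MHS of a `ℚ`-split MHS is `ℚ`-split**: `E_n(S) = ι_ℂ⁻¹(E_n) = (S ∩ U_n)_ℂ` for a `ℚ`-form `U_n`
of `E_n`. [cite: GreenGriffithsKerr2012, §I.C (I.C.7)–(I.C.8)] -/
theorem IsSplitOverQ.subMixedHodgeStructure (h : H.IsSplitOverQ) (S : SubMixedHodgeStructure H) :
    S.toMixedHodgeStructure.IsSplitOverQ := by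
  intro n
  obtain ⟨U, hU⟩ := h n
  refine ⟨U.comap S.toSubmodule.subtype, ?_⟩
  rw [baseChange_comap ℂ, hU, S.deligneE_eq_comap]

/-- **A quotient of a `ℚ`-split MHS is `ℚ`-split**: `E_n(H/S) = π_ℂ(E_n) = (π U_n)_ℂ`.
[cite: GreenGriffithsKerr2012, §I.C (I.C.7)–(I.C.8)] -/
theorem IsSplitOverQ.quotient [FiniteDimensional ℚ V] (h : H.IsSplitOverQ) (S : SubMixedHodgeStructure H) :
    S.quotient.IsSplitOverQ := by
  intro n
  obtain ⟨U, hU⟩ := h n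
  refine ⟨U.map S.toSubmodule.mkQ, ?_⟩
  rw [baseChange_map ℂ, hU, S.deligneE_quotient_eq]

/-- **`ℚ`-splitness is invariant under isomorphisms of MHS.** [cite: GreenGriffithsKerr2012, §I.C (I.C.7)–(I.C.8)] -/
theorem IsSplitOverQ.of_bijective [FiniteDimensional ℚ V] [FiniteDimensional ℚ V'] (h : H.IsSplitOverQ) (f : Hom H H')
    (hf : Function.Bijective f.toLinearMap) : H'.IsSplitOverQ := by
  intro n
  obtain ⟨U, hU⟩ := h n
  refine ⟨U.map f.toLinearMap, ?_⟩
  rw [baseChange_map ℂ, hU, map_deligneE_eq_of_bijective f hf]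

/-- `ℚ`-splitness is invariant under isomorphisms (iff form). [cite: GreenGriffithsKerr2012, §I.C (I.C.7)–(I.C.8)] -/
theorem isSplitOverQ_iff_of_bijective [FiniteDimensional ℚ V] [FiniteDimensional ℚ V'] (f : Hom H H')
    (hf : Function.Bijective f.toLinearMap) : H.IsSplitOverQ ↔ H'.IsSplitOverQ :=
  ⟨fun h => h.of_bijective f hf,
    fun h => h.of_bijective (f.inverse hf) (LinearEquiv.ofBijective f.toLinearMap hf).symm.bijective⟩

/-- The kernel of a morphism out of a `ℚ`-split MHS is `ℚ`-split. [cite: GreenGriffithsKerr2012, §I.C (I.C.7)–(I.C.8)] -/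
theorem IsSplitOverQ.ker (h : H.IsSplitOverQ) (f : Hom H H') : f.ker.toMixedHodgeStructure.IsSplitOverQ :=
  h.subMixedHodgeStructure f.ker

/-- The image of a morphism out of a `ℚ`-split MHS is `ℚ`-split (a quotient of the source).
[cite: GreenGriffithsKerr2012, §I.C (I.C.7)–(I.C.8)] -/
theorem IsSplitOverQ.range [FiniteDimensional ℚ V] [FiniteDimensional ℚ V'] (h : H.IsSplitOverQ) (f : Hom H H') :
    f.range.toMixedHodgeStructure.IsSplitOverQ :=
  (h.quotient f.ker).of_bijective f.coimageToRange f.coimageToRange_bijective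

/-- The image of a morphism into a `ℚ`-split MHS is `ℚ`-split (a sub-object of the target).
[cite: GreenGriffithsKerr2012, §I.C (I.C.7)–(I.C.8)] -/
theorem IsSplitOverQ.range' (h : H'.IsSplitOverQ) (f : Hom H H') : f.range.toMixedHodgeStructure.IsSplitOverQ :=
  h.subMixedHodgeStructure f.range

/-- The cokernel of a morphism into a `ℚ`-split MHS is `ℚ`-split. [cite: GreenGriffithsKerr2012, §I.C (I.C.7)–(I.C.8)] -/
theorem IsSplitOverQ.coker [FiniteDimensional ℚ V'] (h : H'.IsSplitOverQ) (f : Hom H H') : f.coker.IsSplitOverQ :=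
  h.quotient f.range

end MixedHodgeStructure

end Literature.AlgebraicGeometry.Motives
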